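/-
Copyright (c) 2026 the pub-hodgecm-mathlib formalisation cell (harness21).  Prover seat hodgecm-mathlib-K2E3-p14 (g2), Track B «K2-LIT» ∕ h413
(`stmt-HodgeConjecture-24833`), unit U12 «Harish-Chandra characters» of the line `K2_E3_EllipticInputs`, socket U12-h ‹#9L› `sig_K2E3CharLocConstNearRegular`:
brick (Fr) «the congruence frame» of the 9L line lead's depth-halving road (K2E3-p09 (g2), MEMO v4 `K2/K2E3-p09/g2/MEMO-U12h-HF-bricks.v4`, §2), part 1 of 2
(generic levels of a subgroup of `GL_n(F)` and heights); taken as a free hand on the K2 bus 2026-09-03T23:27Z.  2026-09-03.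
-/
import Summits.HodgeConjecture.HodgeConjecture.Theorems.K2E3CongruenceLayerIntertwiningGL   -- ★ p855559 (K2E1b-p08): `mem_overlap_of_mem_congruenceGL_pow_add`, `congruenceGL_pow_add_le`; brings ★ `GLnCongruenceSubgroups` (`congruenceGL`, `ValBound`, `isOpen_congruenceGL`, `isCompact_congruenceGL`, `exists_congruenceGL_subset`, `isOpen_setOf_valBound`), ★ `CongruenceSubgroupExpansionGL` (`conj_mem_congruenceGL`, `IsUniformizingElement`)
import Literature.NumberTheory.Automorphic.ParabolicInductionSupercuspidalProofs              -- ★ `exists_pow_mul_le` (archimedean value group: `|ϖ|^d γ ≤ δ`)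
import HarnessLib

/-!
# Crux `H413` — K2-LIT E3 «EllipticInputs», U12-h brick (Fr), part 1: CONGRUENCE LEVELS `U ∩ K_γ` OF A SUBGROUP `U ≤ GL_n(F)` — compact open, nested, NORMALISED BY
# `U ∩ GL_n(𝒪)` (`∀ x ∈ K₁, K₀.map (conj x) = K₀` in the consumer's bytes), a neighbourhood basis of `1`, every open subgroup contains a deep one — AND HEIGHTS:
# bounded on compact sets, insensitive to integral factors, `K_{m+2h} ⊆ K_m ∩ y K_m y⁻¹` for `y` of height `≤ h`

Cell `hodgecm-mathlib`, Track B «K2-LIT», crux item `stmt-HodgeConjecture-24833` (h413), line `K2_E3_EllipticInputs`, unit U12 «HC characters», socket U12-h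
`sig_K2E3CharLocConstNearRegular` (‹#9L›, `Cruxes/H413/Lines/K2_E3_EllipticInputsSigs_U12Characters.lean` ED. 3 :77).  Brick (Fr) `K2E3UnitaryCongruenceFrame` of the 9L
line lead's brick table (K2E3-p09 (g2) MEMO v4 §2: «`K_m ⊴ K_0` compact open in `(cmDatum L N H).Local v` (all `w ∣ v`), basis of nbhds of `1`, `h(γ t k₀)` bounded on
`γT₁K₀`, `𝒰 = (γT₁)^{K₁}K₀` open `⊇ γK₀`»), free-hand deal — PART 1 (generic, inside `GL_n(F)`); part 2 `K2E3UnitaryCongruenceFrame` transports along the one-place model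
and dresses the CM carrier.  `--supports stmt-HodgeConjecture-24833 --as helper`.  THEOREMS ONLY — no `def`, no named fact, no instance, no notation, no `sorry`.
HONEST LABEL: HC_CM is proved only modulo the 7 printed citations (2 remaining named inputs: hLiu418 = stmt-HodgeConjecture-24832, h413 = stmt-HodgeConjecture-24833) until rung
0 closes; this file is count-neutral topological-group plumbing (it pays no letter by itself).

WHERE IT SITS.  The ★ chain #9 ⟸ 13a ∧ 9L [p855030] · 9L ⟸ 9L_adm [p855081] · 9L_adm ⟸ STAB [p855210] · STAB ⟸ TVAN [p855569] · TVAN ⟸ HF [p855602] is GENERIC in a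
topological group `G` with compact open subgroups `K₀ ≤ K₁`, `K₀` normalised by `K₁` (binder `∀ x ∈ K₁, K₀.map (MulAut.conj x).toMonoidHom = K₀`).  At the frame the
subgroups are traces `U ∩ K_γ` of the principal congruence subgroups ★ `congruenceGL n γ` (`g, g⁻¹` integral, `g − 1, g⁻¹ − 1` with entries `≤ γ`; `K_m = 1 + ϖ^m M_n(𝒪)`
for `γ = |ϖ|^m`) on a subgroup `U ≤ GL_n(F)` (`U = GL_N(L_w)` at a split place, `U = U(σ_w, H_w)(L_w)` at a non-split one), `K₁ = U ∩ K_ν`, `K₀ = U ∩ K_{N₀}`; the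
depth-halving step (C2) conjugates by points `y = k (γt) k⁻¹ k₀` of HEIGHT `≤ h` (entries of `y, y⁻¹` bounded by `(|ϖ|^h)⁻¹`), for which `K_{N′} ∩ y K_{N′} y⁻¹ ⊇ K_{N′+2h}`.

THE MATHEMATICS [BernsteinZelevinsky1976, §1.1 and §3; Casselman1995, §1.4 Prop. 1.4.4; HarishChandra1999, §17 p. 80, §19 pp. 84–86; PlatonovRapinchuk1994, §3.3].
* §1 LEVELS IN A SUBGROUP `U ≤ GL_n(F)`: `(congruenceGL n γ).subgroupOf U` is open (`γ ≠ 0`), compact (`U` closed), monotone in `γ`, NORMALISED by every `x ∈ U` with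
  `x ∈ GL_n(𝒪)` — in the consumer's shape `((congruenceGL n γ).subgroupOf U).map (MulAut.conj x).toMonoidHom = (congruenceGL n γ).subgroupOf U` (★ `conj_mem_congruenceGL`) —
  hence by every element of every level; the levels are a neighbourhood basis of `1` in `U` (trace of ★ `exists_congruenceGL_subset`), in the `|ϖ|^m` indexing too, and every
  open subgroup of `U` contains some `U ∩ K_m`; `U ∩ K_{m+e} ≤ U ∩ K_m` (★ `congruenceGL_pow_add_le`).
* §2 HEIGHTS: integral factors do not raise the height (`k s k⁻¹ k₀` has the height of `s` for `k, k₀ ∈ GL_n(𝒪)`); by ★ `mem_overlap_of_mem_congruenceGL_pow_add` an element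
  of height `≤ h` conjugates `K_{m+2h}` into `K_m`, stated as `K_{m+2h} ≤ K_m ⊓ K_m.map (conj y)` and elementwise; on a COMPACT `S ⊆ GL_n(F)` the entries of `s` and `s⁻¹`
  are uniformly bounded — `∃ h, ∀ s ∈ S, ValBound (|ϖ|^h)⁻¹ s ∧ ValBound (|ϖ|^h)⁻¹ s⁻¹` (a directed open cover by the height sets, ★ `isOpen_setOf_valBound`, over the
  archimedean value group ★ `exists_pow_mul_le`) — the uniform height of the compact torus slice `γT₁` of HC1999 §19.

## References
* [BernsteinZelevinsky1976] I. N. Bernstein, A. V. Zelevinsky, *Representations of the group GL(n,F) where F is a non-archimedean local field*, Russian Math. Surveys 31:3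
  (1976), §1.1 (congruence subgroups are a basis of neighbourhoods of `1`), §3.
* [Casselman1995] W. Casselman, *Introduction to the theory of admissible representations of p-adic reductive groups* (draft 1995), §1.4 Prop. 1.4.4.
* [HarishChandra1999] Harish-Chandra (notes by S. DeBacker and P. J. Sally, Jr.), *Admissible Invariant Distributions on Reductive p-adic Groups*, ULECT 16, AMS (1999): §17
  p. 80 (the lattices `L`, `K = exp L`), §19 Lemmas 19.2–19.4, Cor. 19.5, pp. 84–86 (the torus slice `γT₁`, conjugation by elements of bounded height).
* [PlatonovRapinchuk1994] V. Platonov, A. Rapinchuk, *Algebraic Groups and Number Theory* (1994), §3.3 (congruence subgroups of `G(𝒪_v)`).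
-/

set_option autoImplicit false
-- the mandated namespace repeats `HodgeConjecture.HodgeConjecture`, as in every `Theorems/*.lean` of this sub-problem
set_option linter.dupNamespace false

noncomputable section

open Topology Filter Set ValuativeRel Matrix
open Literature.NumberTheory.Automorphic
open Summit.HodgeConjecture.HodgeConjecture.Cruxes.H413
open scoped MatrixGroups Pointwise

namespace Summit.HodgeConjecture.HodgeConjecture.Cruxes.H413.K2E3SubgroupCongruenceLevels

/-! ## §1 Levels `U ∩ congruenceGL n γ` in a subgroup `U ≤ GL_n(F)` -/

section Levels

variable {F : Type*} [Field F] [ValuativeRel F] {n : ℕ} (U : Subgroup (GL (Fin n) F))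

/-- Membership in the level `U ∩ K_γ` is membership of the underlying matrix in `K_γ = congruenceGL n γ` (definitional). [cite: PlatonovRapinchuk1994, §3.3] -/
theorem mem_congruenceGL_subgroupOf_iff (γ : ValueGroupWithZero F) (x : U) :
    x ∈ (congruenceGL n γ).subgroupOf U ↔ (x : GL (Fin n) F) ∈ congruenceGL n γ :=
  Subgroup.mem_subgroupOf

/-- The levels are MONOTONE in `γ`: `U ∩ K_γ ≤ U ∩ K_δ` for `γ ≤ δ` (★ `congruenceGL_mono`). [cite: BernsteinZelevinsky1976, §3] -/
theorem congruenceGL_subgroupOf_mono {γ δ : ValueGroupWithZero F} (h : γ ≤ δ) :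
    (congruenceGL n γ).subgroupOf U ≤ (congruenceGL n δ).subgroupOf U := fun _ hx =>
  Subgroup.mem_subgroupOf.2 (congruenceGL_mono h (Subgroup.mem_subgroupOf.1 hx))

/-- Every level lies in the integral level `U ∩ GL_n(𝒪)` (★ `congruenceGL_le_glInt`). [cite: PlatonovRapinchuk1994, §3.3] -/
theorem congruenceGL_subgroupOf_le_glInt_subgroupOf (γ : ValueGroupWithZero F) :
    (congruenceGL n γ).subgroupOf U ≤ (glInt n F).subgroupOf U := fun _ hx =>
  Subgroup.mem_subgroupOf.2 (congruenceGL_le_glInt γ (Subgroup.mem_subgroupOf.1 hx))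

/-- **THE LEVELS ARE NORMALISED BY THE INTEGRAL ELEMENTS OF `U`**, in the consumer's bytes (★ p855602 ∕ p855569 binder `∀ x ∈ K₁, K₀.map (MulAut.conj x).toMonoidHom = K₀`):
for `x ∈ U` with `x ∈ GL_n(𝒪)`, `(U ∩ K_γ).map (conj x) = U ∩ K_γ` (★ `conj_mem_congruenceGL`: `K_γ ⊴ GL_n(𝒪)`). [cite: BernsteinZelevinsky1976, §3] [cite: Casselman1995, §1.4 Prop. 1.4.4] -/
theorem map_conj_congruenceGL_subgroupOf {x : U} (hx : (x : GL (Fin n) F) ∈ glInt n F) (γ : ValueGroupWithZero F) :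
    ((congruenceGL n γ).subgroupOf U).map (MulAut.conj x).toMonoidHom = (congruenceGL n γ).subgroupOf U := by
  ext k
  simp only [Subgroup.mem_map, MulEquiv.coe_toMonoidHom, MulAut.conj_apply, Subgroup.mem_subgroupOf]
  constructor
  · rintro ⟨k', hk', rfl⟩
    rw [Subgroup.coe_mul, Subgroup.coe_mul, Subgroup.coe_inv]
    exact conj_mem_congruenceGL hx hk'
  · intro hk
    refine ⟨x⁻¹ * k * x, ?_, by group⟩
    have h := conj_mem_congruenceGL (Subgroup.inv_mem _ hx) hk
    rw [inv_inv] at h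
    rw [Subgroup.coe_mul, Subgroup.coe_mul, Subgroup.coe_inv]
    exact h

/-- … hence BY EVERY ELEMENT OF EVERY LEVEL: `∀ x ∈ U ∩ K_δ, (U ∩ K_γ).map (conj x) = U ∩ K_γ` — literally the `hnK₀` ∕ `hnK'` binder of ★ p855602 with `K₁ = U ∩ K_δ`
(any `δ`, e.g. `K₁ = K_ν ⊇ K₀ = K_{N₀}`). [cite: BernsteinZelevinsky1976, §3] -/
theorem forall_map_conj_congruenceGL_subgroupOf_of_mem (δ γ : ValueGroupWithZero F) :
    ∀ x ∈ (congruenceGL n δ).subgroupOf U, ((congruenceGL n γ).subgroupOf U).map (MulAut.conj x).toMonoidHom = (congruenceGL n γ).subgroupOf U :=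
  fun _ hx => map_conj_congruenceGL_subgroupOf U (congruenceGL_le_glInt δ (Subgroup.mem_subgroupOf.1 hx)) γ

/-- The same with `K₁ = U ∩ GL_n(𝒪)` (the integral level itself). [cite: BernsteinZelevinsky1976, §3] -/
theorem forall_map_conj_congruenceGL_subgroupOf_of_mem_glInt (γ : ValueGroupWithZero F) :
    ∀ x ∈ (glInt n F).subgroupOf U, ((congruenceGL n γ).subgroupOf U).map (MulAut.conj x).toMonoidHom = (congruenceGL n γ).subgroupOf U :=
  fun _ hx => map_conj_congruenceGL_subgroupOf U (Subgroup.mem_subgroupOf.1 hx) γ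

/-- An element of a level conjugates every level into itself (element form of the normalisation). [cite: BernsteinZelevinsky1976, §3] -/
theorem conj_mem_congruenceGL_subgroupOf {x k : U} (hx : (x : GL (Fin n) F) ∈ glInt n F) {γ : ValueGroupWithZero F} (hk : k ∈ (congruenceGL n γ).subgroupOf U) :
    x * k * x⁻¹ ∈ (congruenceGL n γ).subgroupOf U := by
  rw [Subgroup.mem_subgroupOf, Subgroup.coe_mul, Subgroup.coe_mul, Subgroup.coe_inv]
  exact conj_mem_congruenceGL hx (Subgroup.mem_subgroupOf.1 hk)

variable {ϖ : F}

/-- `|ϖ|`-INDEXING: the deep level lies in the shallow one, `U ∩ K_{m+e} ≤ U ∩ K_m` (★ `congruenceGL_pow_add_le`). [cite: HarishChandra1999, §17 p. 80] -/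
theorem congruenceGL_pow_add_subgroupOf_le (hϖ : IsUniformizingElement ϖ) (m e : ℕ) :
    (congruenceGL n (valuation F ϖ ^ (m + e))).subgroupOf U ≤ (congruenceGL n (valuation F ϖ ^ m)).subgroupOf U := fun _ hx =>
  Subgroup.mem_subgroupOf.2 (K2E3CongruenceLayerIntertwiningGL.congruenceGL_pow_add_le hϖ m e (Subgroup.mem_subgroupOf.1 hx))

/-- `U ∩ K_{m'} ≤ U ∩ K_m` for `m ≤ m'`. [cite: HarishChandra1999, §17 p. 80] -/
theorem congruenceGL_pow_subgroupOf_le_of_le (hϖ : IsUniformizingElement ϖ) {m m' : ℕ} (h : m ≤ m') :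
    (congruenceGL n (valuation F ϖ ^ m')).subgroupOf U ≤ (congruenceGL n (valuation F ϖ ^ m)).subgroupOf U := by
  obtain ⟨e, rfl⟩ := Nat.exists_eq_add_of_le h
  exact congruenceGL_pow_add_subgroupOf_le U hϖ m e

end Levels

/-! ## §1 (topology) Compact open, a neighbourhood basis of `1`, every open subgroup contains a deep level -/

section LevelsTopology

variable {F : Type*} [Field F] [ValuativeRel F] [TopologicalSpace F] [IsNonarchimedeanLocalField F] {n : ℕ} (U : Subgroup (GL (Fin n) F))

/-- **`U ∩ K_γ` IS OPEN in `U`** for `γ ≠ 0` (★ `isOpen_congruenceGL`, subspace topology). [cite: BernsteinZelevinsky1976, §1.1] -/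
theorem isOpen_congruenceGL_subgroupOf {γ : ValueGroupWithZero F} (hγ : γ ≠ 0) :
    IsOpen (((congruenceGL n γ).subgroupOf U : Subgroup U) : Set U) :=
  (isOpen_congruenceGL hγ).preimage continuous_subtype_val

/-- **`U ∩ K_γ` IS COMPACT in `U`** when `U` is closed in `GL_n(F)` (★ `isCompact_congruenceGL`; `Subtype.val` is then a closed embedding). [cite: PlatonovRapinchuk1994, §3.3] -/
theorem isCompact_congruenceGL_subgroupOf (hU : IsClosed (U : Set (GL (Fin n) F))) (γ : ValueGroupWithZero F) :
    IsCompact (((congruenceGL n γ).subgroupOf U : Subgroup U) : Set U) :=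
  hU.isClosedEmbedding_subtypeVal.isCompact_preimage (isCompact_congruenceGL γ)

/-- **THE LEVELS ARE A NEIGHBOURHOOD BASIS OF `1` IN `U`**: every `O ∈ 𝓝 1` contains `U ∩ K_γ` for some unit `γ` (★ `exists_congruenceGL_subset` read in the subspace topology).
[cite: BernsteinZelevinsky1976, §1.1] [cite: Casselman1995, §1.4 Prop. 1.4.4] -/
theorem exists_congruenceGL_subgroupOf_subset {O : Set U} (hO : O ∈ 𝓝 (1 : U)) :
    ∃ γ : (ValueGroupWithZero F)ˣ, (((congruenceGL n (γ : ValueGroupWithZero F)).subgroupOf U : Subgroup U) : Set U) ⊆ O := by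
  obtain ⟨O', hO', hsub⟩ := (mem_nhds_subtype _ (1 : U) O).1 hO
  rw [OneMemClass.coe_one] at hO'
  obtain ⟨γ, hγ⟩ := exists_congruenceGL_subset hO'
  exact ⟨γ, fun k hk => hsub (hγ (Subgroup.mem_subgroupOf.1 hk))⟩

variable {ϖ : F}

/-- The same in the `|ϖ|^m` indexing (`ϖ ≠ 0`, `|ϖ| < 1`): every `O ∈ 𝓝 1` contains `U ∩ K_m` for some `m` (★ `exists_pow_mul_le`: `|ϖ|^m ≤ γ`). [cite: BernsteinZelevinsky1976, §1.1] -/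
theorem exists_congruenceGL_pow_subgroupOf_subset (hϖ0 : ϖ ≠ 0) (hϖ1 : valuation F ϖ < 1) {O : Set U} (hO : O ∈ 𝓝 (1 : U)) :
    ∃ m : ℕ, (((congruenceGL n (valuation F ϖ ^ m)).subgroupOf U : Subgroup U) : Set U) ⊆ O := by
  obtain ⟨γ, hγ⟩ := exists_congruenceGL_subgroupOf_subset U hO
  obtain ⟨m, hm⟩ := exists_pow_mul_le ((Valuation.ne_zero_iff _).2 hϖ0) hϖ1 (1 : ValueGroupWithZero F) (Units.ne_zero γ)
  rw [mul_one] at hm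
  exact ⟨m, fun k hk => hγ (congruenceGL_subgroupOf_mono U hm hk)⟩

/-- **EVERY OPEN SUBGROUP `K′ ≤ U` CONTAINS A DEEP LEVEL `U ∩ K_m`** (so the DEPTH of a `K′`-fixed type is well defined). [cite: BernsteinZelevinsky1976, §1.1] -/
theorem exists_congruenceGL_pow_subgroupOf_le (hϖ0 : ϖ ≠ 0) (hϖ1 : valuation F ϖ < 1) {K' : Subgroup U} (hK' : IsOpen (K' : Set U)) :
    ∃ m : ℕ, (congruenceGL n (valuation F ϖ ^ m)).subgroupOf U ≤ K' := by
  obtain ⟨m, hm⟩ := exists_congruenceGL_pow_subgroupOf_subset U hϖ0 hϖ1 (hK'.mem_nhds (Subgroup.one_mem K'))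
  exact ⟨m, fun k hk => hm hk⟩

/-- The unit-indexed version of the last statement. [cite: BernsteinZelevinsky1976, §1.1] -/
theorem exists_congruenceGL_subgroupOf_le {K' : Subgroup U} (hK' : IsOpen (K' : Set U)) :
    ∃ γ : (ValueGroupWithZero F)ˣ, (congruenceGL n (γ : ValueGroupWithZero F)).subgroupOf U ≤ K' := by
  obtain ⟨γ, hγ⟩ := exists_congruenceGL_subgroupOf_subset U (hK'.mem_nhds (Subgroup.one_mem K'))
  exact ⟨γ, fun k hk => hγ hk⟩

end LevelsTopology

/-! ## §2 Heights: bounded on compact sets, insensitive to integral factors; the overlap `K_{m+2h} ⊆ K_m ∩ y K_m y⁻¹` -/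

section Height

variable {F : Type*} [Field F] [ValuativeRel F] {n : ℕ} {ϖ : F}

/-- Integral factors on the left do not raise an entrywise bound: `ValBound η (κ X)` for `κ ∈ GL_n(𝒪)`, `ValBound η X`. [cite: HarishChandra1999, §17 p. 80] -/
theorem valBound_coe_mul_of_mem_glInt {η : ValueGroupWithZero F} {κ : GL (Fin n) F} (hκ : κ ∈ glInt n F) {X : Matrix (Fin n) (Fin n) F} (hX : ValBound η X) :
    ValBound η ((κ : Matrix (Fin n) (Fin n) F) * X) := by
  simpa only [one_mul] using (valBound_one_of_mem_glInt hκ).mul hX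

/-- Integral factors on the right do not raise an entrywise bound. [cite: HarishChandra1999, §17 p. 80] -/
theorem valBound_mul_coe_of_mem_glInt {η : ValueGroupWithZero F} {κ : GL (Fin n) F} (hκ : κ ∈ glInt n F) {X : Matrix (Fin n) (Fin n) F} (hX : ValBound η X) :
    ValBound η (X * (κ : Matrix (Fin n) (Fin n) F)) := by
  simpa only [mul_one] using hX.mul (valBound_one_of_mem_glInt hκ)

/-- **`y = k s k⁻¹ k₀` HAS THE HEIGHT OF `s`** for `k, k₀ ∈ GL_n(𝒪)`: if the entries of `s` and `s⁻¹` are `≤ η` then so are those of `y` and `y⁻¹` (the points of the slice set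
`𝒰 = (K₁ S K₁⁻¹) K₀` have the height of the torus slice `S`). [cite: HarishChandra1999, §19 pp. 84–86] -/
theorem valBound_conj_mul_of_mem_glInt {η : ValueGroupWithZero F} {k s k₀ : GL (Fin n) F} (hk : k ∈ glInt n F) (hk₀ : k₀ ∈ glInt n F)
    (hs : ValBound η (s : Matrix (Fin n) (Fin n) F)) (hs' : ValBound η ((s⁻¹ : GL (Fin n) F) : Matrix (Fin n) (Fin n) F)) :
    ValBound η ((k * s * k⁻¹ * k₀ : GL (Fin n) F) : Matrix (Fin n) (Fin n) F) ∧
      ValBound η (((k * s * k⁻¹ * k₀)⁻¹ : GL (Fin n) F) : Matrix (Fin n) (Fin n) F) := by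
  constructor
  · rw [Units.val_mul, Units.val_mul, Units.val_mul]
    exact valBound_mul_coe_of_mem_glInt hk₀ (valBound_mul_coe_of_mem_glInt (Subgroup.inv_mem _ hk) (valBound_coe_mul_of_mem_glInt hk hs))
  · rw [show (k * s * k⁻¹ * k₀)⁻¹ = k₀⁻¹ * (k * s⁻¹ * k⁻¹) by group, Units.val_mul, Units.val_mul, Units.val_mul]
    exact valBound_coe_mul_of_mem_glInt (Subgroup.inv_mem _ hk₀)
      (valBound_mul_coe_of_mem_glInt (Subgroup.inv_mem _ hk) (valBound_coe_mul_of_mem_glInt hk hs'))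

/-- **THE OVERLAP**: an element `y` of height `≤ h` conjugates `K_{m+2h}` into `K_m`, in both directions, so `K_{m+2h} ⊆ K_m ∩ y K_m y⁻¹ ∩ y⁻¹ K_m y` (★
`mem_overlap_of_mem_congruenceGL_pow_add`, restated for the frame: the subgroup on which «`y` intertwines the type with itself» is tested contains the deep level).
[cite: HarishChandra1999, §17 Cor. 17.2, §19 Lemma 19.4] -/
theorem congruenceGL_pow_add_two_mul_le_inf_map_conj (hϖ : IsUniformizingElement ϖ) (m h : ℕ) {y : GL (Fin n) F}
    (hy : ValBound (valuation F ϖ ^ h)⁻¹ (y : Matrix (Fin n) (Fin n) F)) (hy' : ValBound (valuation F ϖ ^ h)⁻¹ ((y⁻¹ : GL (Fin n) F) : Matrix (Fin n) (Fin n) F)) :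
    congruenceGL n (valuation F ϖ ^ (m + 2 * h)) ≤
      congruenceGL n (valuation F ϖ ^ m) ⊓ (congruenceGL n (valuation F ϖ ^ m)).map (MulAut.conj y).toMonoidHom := by
  intro k hk
  obtain ⟨h₁, -, h₃⟩ := K2E3CongruenceLayerIntertwiningGL.mem_overlap_of_mem_congruenceGL_pow_add hϖ m h hy hy' hk
  refine Subgroup.mem_inf.2 ⟨h₁, Subgroup.mem_map.2 ⟨y⁻¹ * k * y, h₃, ?_⟩⟩
  rw [MulEquiv.coe_toMonoidHom, MulAut.conj_apply]
  group

/-- Element form of the overlap for the consumer's binder `∀ z ∈ K₁, y⁻¹ * z * y ∈ K₁ → …`: for `z ∈ K_{m+2h}` and `y` of height `≤ h`, both `z` and `y⁻¹ z y` lie in `K_m`.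
[cite: HarishChandra1999, §19 Lemma 19.4] -/
theorem mem_and_inv_conj_mem_congruenceGL_pow (hϖ : IsUniformizingElement ϖ) (m h : ℕ) {y z : GL (Fin n) F}
    (hy : ValBound (valuation F ϖ ^ h)⁻¹ (y : Matrix (Fin n) (Fin n) F)) (hy' : ValBound (valuation F ϖ ^ h)⁻¹ ((y⁻¹ : GL (Fin n) F) : Matrix (Fin n) (Fin n) F))
    (hz : z ∈ congruenceGL n (valuation F ϖ ^ (m + 2 * h))) :
    z ∈ congruenceGL n (valuation F ϖ ^ m) ∧ y⁻¹ * z * y ∈ congruenceGL n (valuation F ϖ ^ m) :=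
  let t := K2E3CongruenceLayerIntertwiningGL.mem_overlap_of_mem_congruenceGL_pow_add hϖ m h hy hy' hz
  ⟨t.1, t.2.2⟩

end Height

section HeightCompact

variable {F : Type*} [Field F] [ValuativeRel F] {n : ℕ} {ϖ : F}

/-- The height bounds `(|ϖ|^h)⁻¹` increase with `h`. [cite: HarishChandra1999, §17 p. 80] -/
theorem inv_pow_le_inv_pow_of_le (hϖ0 : ϖ ≠ 0) (hϖ1 : valuation F ϖ < 1) {h h' : ℕ} (hh : h ≤ h') :
    (valuation F ϖ ^ h)⁻¹ ≤ (valuation F ϖ ^ h')⁻¹ := by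
  have hv0 : valuation F ϖ ≠ 0 := (Valuation.ne_zero_iff _).2 hϖ0
  exact inv_anti₀ (pow_pos (zero_lt_iff.2 hv0) h') (pow_le_pow_right_of_le_one' hϖ1.le hh)

variable [TopologicalSpace F] [IsNonarchimedeanLocalField F]

/-- Every field element is eventually height-bounded: `v x ≤ (|ϖ|^h)⁻¹` for all large `h` (`ϖ ≠ 0`, `|ϖ| < 1`; archimedean value group). [cite: BernsteinZelevinsky1976, §1.1] -/
theorem exists_forall_le_valuation_le_inv_pow (hϖ0 : ϖ ≠ 0) (hϖ1 : valuation F ϖ < 1) (x : F) :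
    ∃ d : ℕ, ∀ h : ℕ, d ≤ h → valuation F x ≤ (valuation F ϖ ^ h)⁻¹ := by
  have hv0 : valuation F ϖ ≠ 0 := (Valuation.ne_zero_iff _).2 hϖ0
  obtain ⟨d, hd⟩ := exists_pow_mul_le hv0 hϖ1 (valuation F x) (one_ne_zero' (ValueGroupWithZero F))
  refine ⟨d, fun h hdh => ?_⟩
  have hpos : 0 < valuation F ϖ ^ h := pow_pos (zero_lt_iff.2 hv0) h
  rw [← one_mul (valuation F ϖ ^ h)⁻¹, le_mul_inv_iff₀ hpos]
  calc valuation F x * valuation F ϖ ^ h = valuation F ϖ ^ h * valuation F x := mul_comm _ _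
    _ ≤ valuation F ϖ ^ d * valuation F x := mul_le_mul' (pow_le_pow_right_of_le_one' hϖ1.le hdh) le_rfl
    _ ≤ 1 := hd

/-- **HEIGHTS ARE BOUNDED ON COMPACT SETS**: for a compact `S ⊆ GL_n(F)` there is `h` with `ValBound (|ϖ|^h)⁻¹ s` and `ValBound (|ϖ|^h)⁻¹ s⁻¹` for every `s ∈ S` — the uniform
height of the torus slice `γT₁` (and hence of `𝒰 = (K₁ γT₁ K₁⁻¹) K₀`, §2) in HC1999 §19.  Proof: the height sets form a directed open cover of `GL_n(F)` (★ `isOpen_setOf_valBound`).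
[cite: HarishChandra1999, §19 pp. 84–86] [cite: BernsteinZelevinsky1976, §1.1] -/
theorem exists_height_of_isCompact (hϖ0 : ϖ ≠ 0) (hϖ1 : valuation F ϖ < 1) {S : Set (GL (Fin n) F)} (hS : IsCompact S) :
    ∃ h : ℕ, ∀ s ∈ S, ValBound (valuation F ϖ ^ h)⁻¹ (s : Matrix (Fin n) (Fin n) F) ∧
      ValBound (valuation F ϖ ^ h)⁻¹ ((s⁻¹ : GL (Fin n) F) : Matrix (Fin n) (Fin n) F) := by
  have hv0 : valuation F ϖ ≠ 0 := (Valuation.ne_zero_iff _).2 hϖ0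
  -- the height sets
  let A : ℕ → Set (GL (Fin n) F) := fun h =>
    {g | ValBound (valuation F ϖ ^ h)⁻¹ (g : Matrix (Fin n) (Fin n) F)} ∩ {g | ValBound (valuation F ϖ ^ h)⁻¹ ((g⁻¹ : GL (Fin n) F) : Matrix (Fin n) (Fin n) F)}
  have hAo : ∀ h, IsOpen (A h) := fun h =>
    (isOpen_setOf_valBound Units.continuous_val (inv_ne_zero (pow_ne_zero _ hv0))).inter
      (isOpen_setOf_valBound Units.continuous_coe_inv (inv_ne_zero (pow_ne_zero _ hv0)))
  have hAmono : ∀ {h h' : ℕ}, h ≤ h' → A h ⊆ A h' := fun hh g hg =>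
    ⟨hg.1.mono (inv_pow_le_inv_pow_of_le hϖ0 hϖ1 hh), hg.2.mono (inv_pow_le_inv_pow_of_le hϖ0 hϖ1 hh)⟩
  have hAdir : Directed (· ⊆ ·) A := fun h h' => ⟨max h h', hAmono (le_max_left _ _), hAmono (le_max_right _ _)⟩
  -- they cover `GL_n(F)`: finitely many entries, each eventually bounded
  have hcov : S ⊆ ⋃ h, A h := by
    intro g _
    choose d hd using fun p : Fin n × Fin n => exists_forall_le_valuation_le_inv_pow hϖ0 hϖ1 ((g : Matrix (Fin n) (Fin n) F) p.1 p.2)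
    choose d' hd' using fun p : Fin n × Fin n => exists_forall_le_valuation_le_inv_pow hϖ0 hϖ1 (((g⁻¹ : GL (Fin n) F) : Matrix (Fin n) (Fin n) F) p.1 p.2)
    refine Set.mem_iUnion.2 ⟨Finset.univ.sup d + Finset.univ.sup d', fun i j => ?_, fun i j => ?_⟩
    · exact hd (i, j) _ ((Finset.le_sup (Finset.mem_univ (i, j))).trans (Nat.le_add_right _ _))
    · exact hd' (i, j) _ ((Finset.le_sup (Finset.mem_univ (i, j))).trans (Nat.le_add_left _ _))
  obtain ⟨h, hh⟩ := hS.elim_directed_cover A hAo hcov hAdir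
  exact ⟨h, fun s hs => hh hs⟩

/-- **… and on compact subsets of a subgroup `U ≤ GL_n(F)`** (read through `Subtype.val`). [cite: HarishChandra1999, §19 pp. 84–86] -/
theorem exists_height_of_isCompact_subgroup (hϖ0 : ϖ ≠ 0) (hϖ1 : valuation F ϖ < 1) (U : Subgroup (GL (Fin n) F)) {S : Set U} (hS : IsCompact S) :
    ∃ h : ℕ, ∀ s ∈ S, ValBound (valuation F ϖ ^ h)⁻¹ ((s : GL (Fin n) F) : Matrix (Fin n) (Fin n) F) ∧
      ValBound (valuation F ϖ ^ h)⁻¹ (((s : GL (Fin n) F)⁻¹ : GL (Fin n) F) : Matrix (Fin n) (Fin n) F) := by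
  obtain ⟨h, hh⟩ := exists_height_of_isCompact hϖ0 hϖ1 (hS.image continuous_subtype_val)
  exact ⟨h, fun s hs => hh _ (Set.mem_image_of_mem _ hs)⟩

end HeightCompact

end Summit.HodgeConjecture.HodgeConjecture.Cruxes.H413.K2E3SubgroupCongruenceLevels

end
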